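import Summits.BirchSwinnertonDyer.BirchSwinnertonDyer.Theorems.SmallImageMuTransferMuTransferX9LocalTwistOperator
import HarnessLib

/-!
# K6 crux `MuTransferX9` (stmt-BirchSwinnertonDyer-19276), skeleton v5 stub `stub_stepsTwoFourX9`:
# the DIVISION STEP of MU-TRANSFER-PROOF §3 Lemma 2 in the arithmetic of `𝒯_J = M ⊗ 𝔽_p[T]/T^J`
# — from the key relation `(φ̃ − 1)·t_N = −P·t_1` at level `J'` to the value
# `t_N ≡ −U·T^e·t_1 (mod T^J)` at every level `J ≤ J' − e` (pure `Fin J → M` algebra)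

Cell `bsd-smallim`, seat `bsd-smallim-k6-g3` (gen 0).  THEOREMS ONLY (no definition, no named fact,
no `sorry`); curve-free.  HONEST FRAMING: helper toward the registered stub `stub_stepsTwoFourX9`
(the transverse value `U·T^{e+a}·k₁` of the Kolyvagin class); closes nothing.  PARTITION (D-0054):
X9 (A4) — helper; closes NONE.  Companion of `…X9KolyvaginClassTwist.lean` (whose
`rho_sub_eq_of_norm_witness` delivers the key relation `(ρ(Fr) − 1)·a = n•y(Fr) − w(Fr)`, i.e. with
`n·𝒯 = 0` and `w = P_op ∘ φ_1`: `(φ̃ − 1)·a = −P_op t_1`) and of koly's `…X9LocalTwistOperator.lean`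
((F5) in operator form: `φ̃ − 1 = (1+S)^{p^m u} − 1 = S^{p^m}·V`, `V` a unit; fixed points of `φ̃` =
`ker S^{p^m}`).

WHY A SEPARATE STEP (MU-TRANSFER-PROOF §3, "`t_N = −u_P·φ̃⁻¹Q^𝒯(φ̃⁻¹)·t_1`").  The memo divides by
`φ̃ − 1 = T^e·unit` in the torsion-free `Ω`-module `𝒯`; at a finite level `𝒯_{J'}` this division
loses `e` digits of `T`-adic precision: `(φ̃ − 1)(a + c) = 0` only gives `a + c ∈ 𝒯_{J'}^{φ̃=1} =
ker S^e = T^{J'−e}𝒯_{J'}`, i.e. `a ≡ −c` modulo `T^{J'−e}`.  With `J' = pe ≥ 3e` (the Shapiro level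
of depth `m+1`) and `J = 2e` (the level of the skeleton's `Φ`) this is exactly enough.

* `castLE_eq_zero_of_shiftEnd_pow_apply_eq_zero` — `S^e x = 0` in `Fin J' → M` ⟹ the truncation of
  `x` to any level `J` with `J + e ≤ J'` vanishes (`ker S^e = T^{J'−e}𝒯_{J'}`, koly's
  `shiftEnd_pow_apply_eq_zero_iff`).
* `castLE_eq_zero_of_unipotentPow_apply_eq_self` — a vector fixed by `φ̃ = (1+S)^{p^m u}` (`p ∤ u`)
  truncates to `0` at level `J ≤ J' − p^m` (koly's `unipotentPow_apply_eq_self_iff`).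
* **`castLE_eq_neg_castLE_of_sub_one_apply_eq`** — the division: `(φ̃ − 1) a = −(φ̃ − 1) c` ⟹
  `a ≡ −c (mod T^{J'−p^m})`, as an equality of truncations at every level `J ≤ J' − p^m`.
* `exists_poly_unipotentPow_sub_one_eq` — (F5) with the unit as a POLYNOMIAL in `S` with constant
  term `u` (the shape `aeval (shiftEnd …) U`, `¬ p ∣ U.coeff 0` of the stub's conclusion):
  `(1+S)^{p^m u} − 1 = S^{p^m} ∘ V(S)`, `V = u + X^{p^m}·r`; `unipotentPow_eq_aeval` —
  `(1+S)^c = ((1+X)^c)(S)`, constant term `1`.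
* `castLE_shiftEnd_pow_apply`, `castLE_aeval_shiftEnd_apply` — truncation commutes with `S^k` and with
  every polynomial in `S` (so `−c = −S^e·V(S)·W(S)·t_1` truncates to `−S^e·(VW)(S)·(t_1 mod T^J)`:
  the memo's `U·T^e·t̄_1`, `U = VW` a unit of `A_J`).

References: HOME/koly/MU-TRANSFER-PROOF.md §3 (COCHAINS: the key formula), (F5); L. Washington,
*Introduction to Cyclotomic Fields* (1997) §13.2 [Washington1997]; B. Perrin-Riou, Ann. Inst. Fourier
48 (1998) Prop. 2.2.5, Prop. 3.1.6 (the congruence identifying the singular value) [PerrinRiou1998AIF].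
-/

-- the summit and its single problem are both named `BirchSwinnertonDyer` (registry layout D-0017)
set_option linter.dupNamespace false
set_option autoImplicit false

noncomputable section

open Function Finset Polynomial
open Literature.NumberTheory.EllipticCurves
open Summit.BirchSwinnertonDyer.BirchSwinnertonDyer.Rank1Residual.LocalSplitPrime

namespace Summit.BirchSwinnertonDyer.BirchSwinnertonDyer.Rank1Residual.KolyvaginTwist

variable {M : Type*} [AddCommGroup M] {p : ℕ}

/-! ### §1 Truncation kills the kernel of `S^e` -/

/-- **`ker S^e` truncates to zero**: if `S^e x = 0` in `Fin J' → M` (`x ∈ T^{J'−e}𝒯_{J'}`) then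
`x mod T^J = 0` for every `J` with `J + e ≤ J'` (truncation = restriction to the first `J`
coordinates, `Fin.castLE`, as in `ZpExtension.twistModPTruncate`). [cite: Washington1997, §13.1–§13.2] -/
theorem castLE_eq_zero_of_shiftEnd_pow_apply_eq_zero {J' J e : ℕ} (hJ : J + e ≤ J') (x : Fin J' → M)
    (hx : (shiftEnd M J' ^ e) x = 0) :
    (fun i : Fin J => x (Fin.castLE (by omega) i)) = 0 := by
  rw [shiftEnd_pow_apply_eq_zero_iff] at hx
  funext i
  exact hx (Fin.castLE (by omega) i) (by simp; omega)

variable [Fact p.Prime]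

/-- **A `φ̃`-fixed vector truncates to zero**: for `φ̃ = (1+S)^{p^m u}` with `p ∤ u` on `Fin J' → M`
(`p·M = 0`), `φ̃ x = x` ⟹ `x mod T^J = 0` whenever `J + p^m ≤ J'` (`𝒯_{J'}^{φ̃=1} = ker S^{p^m}`,
koly's `unipotentPow_apply_eq_self_iff`). [cite: Washington1997, §13.2 (arithmetic in Λ/(p, T^n))] -/
theorem castLE_eq_zero_of_unipotentPow_apply_eq_self (hM : ∀ x : M, p • x = 0) {J' J : ℕ} (m u : ℕ)
    (hu : ¬ p ∣ u) (hJ : J + p ^ m ≤ J') (x : Fin J' → M)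
    (hx : unipotentPow M J' (p ^ m * u) x = x) :
    (fun i : Fin J => x (Fin.castLE (by omega) i)) = 0 :=
  castLE_eq_zero_of_shiftEnd_pow_apply_eq_zero hJ x
    ((unipotentPow_apply_eq_self_iff hM m u hu x).mp hx)

/-- **The division step** (MU-TRANSFER-PROOF §3 "`(φ̃ − 1)t_N = −P·t_1 ⟹ t_N = −U'T^e t_1`", at
finite level): if `(φ̃ − 1) a = −(φ̃ − 1) c` in `Fin J' → M` for `φ̃ = (1+S)^{p^m u}`, `p ∤ u`
(e.g. `c = φ̃⁻¹Q(φ̃⁻¹)u_P·t_1`, so that `(φ̃−1)c = P·t_1`), then `a ≡ −c (mod T^{J'−p^m})`: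
their truncations to every level `J` with `J + p^m ≤ J'` satisfy `a mod T^J = −(c mod T^J)`.
[cite: Washington1997, §13.2 (arithmetic in Λ/(p, T^n))] -/
theorem castLE_eq_neg_castLE_of_sub_one_apply_eq (hM : ∀ x : M, p • x = 0) {J' J : ℕ} (m u : ℕ)
    (hu : ¬ p ∣ u) (hJ : J + p ^ m ≤ J') (a c : Fin J' → M)
    (hrel : (unipotentPow M J' (p ^ m * u) - 1) a = -((unipotentPow M J' (p ^ m * u) - 1) c)) :
    (fun i : Fin J => a (Fin.castLE (by omega) i)) = fun i => -c (Fin.castLE (by omega) i) := by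
  have hfix : unipotentPow M J' (p ^ m * u) (a + c) = a + c := by
    have h : (unipotentPow M J' (p ^ m * u) - 1) (a + c) = 0 := by
      rw [map_add, hrel, neg_add_cancel]
    rw [LinearMap.sub_apply, Module.End.one_apply, sub_eq_zero] at h
    exact h
  have h0 := castLE_eq_zero_of_unipotentPow_apply_eq_self hM m u hu hJ (a + c) hfix
  funext i
  have hi := congrFun h0 i
  rw [Pi.add_apply, Pi.zero_apply] at hi
  exact eq_neg_of_add_eq_zero_left hi

/-! ### §2 The unit as a polynomial in `S` -/

omit [Fact p.Prime] in
/-- `(1+S)^c` is the polynomial `(1+X)^c` evaluated at the shift; its constant term is `1`.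
[cite: Washington1997, §13.1–§13.2] -/
theorem unipotentPow_eq_aeval {J : ℕ} (c : ℕ) :
    unipotentPow M J c = aeval (shiftEnd M J) (((1 : ℤ[X]) + X) ^ c) ∧
      (((1 : ℤ[X]) + X) ^ c).coeff 0 = 1 := by
  refine ⟨?_, ?_⟩
  · rw [unipotentPow, map_pow, map_add, map_one, aeval_X]
  · rw [coeff_zero_eq_eval_zero, eval_pow, eval_add, eval_one, eval_X, add_zero, one_pow]

/-- **(F5) with a polynomial unit**: on `Fin J → M` with `p·M = 0`,
`(1+S)^{p^m·u} − 1 = S^{p^m} ∘ V(S)` for the polynomial `V = u + X^{p^m}·r ∈ ℤ[X]` (binomial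
expansion to second order in characteristic `p`), whose constant term is `u` as soon as `m`-th
power… i.e. always (`p^m ≥ 1`); so `p ∤ V(0)` iff `p ∤ u`.  The ENDOMORPHISM form with `V` a unit
is koly's `unipotentPow_sub_one_eq_shiftEnd_pow_mul_unit`. [cite: Washington1997, §13.2 (arithmetic in Λ/(p, T^n))] -/
theorem exists_poly_unipotentPow_sub_one_eq (hM : ∀ x : M, p • x = 0) {J : ℕ} (m u : ℕ) :
    ∃ V : ℤ[X], V.coeff 0 = (u : ℤ) ∧
      unipotentPow M J (p ^ m * u) - 1 = shiftEnd M J ^ (p ^ m) * aeval (shiftEnd M J) V := by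
  obtain ⟨r, hr⟩ := one_add_X_pow_pow_eq (p ^ m) u
  refine ⟨(u : ℤ[X]) + X ^ (p ^ m) * r, ?_, ?_⟩
  · have hpm : p ^ m ≠ 0 := pow_ne_zero m (Fact.out : p.Prime).ne_zero
    rw [coeff_add, coeff_X_pow_mul', if_neg (by omega)]
    simp
  · set S : Module.End ℤ (Fin J → M) := shiftEnd M J with hS
    have hexp : (1 + S ^ (p ^ m)) ^ u =
        1 + (u : Module.End ℤ (Fin J → M)) * S ^ (p ^ m) + (S ^ (p ^ m)) ^ 2 * aeval S r := by
      have h := congrArg (aeval S) hr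
      simpa [map_pow, map_add, map_mul, map_natCast, aeval_X, aeval_one] using h
    rw [unipotentPow, pow_mul, ← unipotentPow, unipotentPow_prime_pow_eq_one_add hM m, ← hS, hexp,
      map_add, map_mul, map_natCast, map_pow, aeval_X]
    rw [add_assoc, add_sub_cancel_left, mul_add, pow_two, mul_assoc, (Nat.cast_commute u _).eq]

/-! ### §3 Truncation commutes with the `𝔽_p[S]`-structure -/

omit [Fact p.Prime] in
/-- Truncation commutes with powers of the shift: `(S^k x) mod T^J = S^k (x mod T^J)`.
[cite: Washington1997, §13.1–§13.2] -/
theorem castLE_shiftEnd_pow_apply {J' J : ℕ} (hJ : J ≤ J') (k : ℕ) (x : Fin J' → M) :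
    (fun i : Fin J => (shiftEnd M J' ^ k) x (Fin.castLE hJ i)) =
      (shiftEnd M J ^ k) fun i => x (Fin.castLE hJ i) := by
  induction k generalizing x with
  | zero => rfl
  | succ k ih =>
    rw [pow_succ, pow_succ, Module.End.mul_apply, Module.End.mul_apply, ih (shiftEnd M J' x),
      ZpExtension.shiftEnd_comp_castLE J' hJ x]

omit [Fact p.Prime] in
/-- Truncation commutes with every polynomial in the shift: `(U(S) x) mod T^J = U(S) (x mod T^J)`
(truncation is `𝔽_p[T]`-linear). [cite: Washington1997, §13.1–§13.2] -/
theorem castLE_aeval_shiftEnd_apply {J' J : ℕ} (hJ : J ≤ J') (U : ℤ[X]) (x : Fin J' → M) :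
    (fun i : Fin J => aeval (shiftEnd M J') U x (Fin.castLE hJ i)) =
      aeval (shiftEnd M J) U fun i => x (Fin.castLE hJ i) := by
  -- truncation as a linear map
  let τ : (Fin J' → M) →ₗ[ℤ] (Fin J → M) :=
    { toFun := fun y i => y (Fin.castLE hJ i)
      map_add' := fun _ _ => rfl
      map_smul' := fun _ _ => rfl }
  have hτ : ∀ y, τ (shiftEnd M J' y) = shiftEnd M J (τ y) := fun y =>
    ZpExtension.shiftEnd_comp_castLE J' hJ y
  change τ (aeval (shiftEnd M J') U x) = aeval (shiftEnd M J) U (τ x)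
  rw [aeval_eq_sum_range, aeval_eq_sum_range, LinearMap.sum_apply, LinearMap.sum_apply, map_sum]
  refine sum_congr rfl fun k _ => ?_
  rw [LinearMap.smul_apply, LinearMap.smul_apply, map_smul]
  congr 1
  exact castLE_shiftEnd_pow_apply hJ k x

/-- **The memo's value, assembled** (MU-TRANSFER-PROOF §3: `κ̃(σ) = −t_N = U'·T^e·t̄_1`): if
`(φ̃ − 1) a = −(φ̃ − 1) c` at level `J'` with `φ̃ = (1+S)^{p^m u}`, `p ∤ u`, and
`c = S^e·W(S)·t` (`W ∈ ℤ[X]`; in the application `e = p^m` and `W = V·(unit)` from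
`exists_poly_unipotentPow_sub_one_eq`), then at every level `J` with `J + p^m ≤ J'` the NEGATIVE of
the truncation of `a` — the value `Φ(σ) = −a` of the Kolyvagin cocycle
(`KolyvaginTwist.exists_kolyvaginCocycle`), truncated — is `S^e·W(S)·(t mod T^J)`.
[cite: PerrinRiou1998AIF, Prop. 2.2.5 and Prop. 3.1.6] -/
theorem neg_castLE_eq_shiftEnd_pow_aeval_castLE (hM : ∀ x : M, p • x = 0) {J' J : ℕ} (m u : ℕ)
    (hu : ¬ p ∣ u) (hJ : J + p ^ m ≤ J') (a t : Fin J' → M) (e : ℕ) (W : ℤ[X])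
    (hrel : (unipotentPow M J' (p ^ m * u) - 1) a =
      -((unipotentPow M J' (p ^ m * u) - 1) ((shiftEnd M J' ^ e) (aeval (shiftEnd M J') W t)))) :
    (fun i : Fin J => -a (Fin.castLE (by omega) i)) =
      (shiftEnd M J ^ e) (aeval (shiftEnd M J) W fun i => t (Fin.castLE (by omega) i)) := by
  have h := castLE_eq_neg_castLE_of_sub_one_apply_eq hM m u hu hJ a _ hrel
  have hJle : J ≤ J' := by omega
  rw [← castLE_aeval_shiftEnd_apply hJle W t, ← castLE_shiftEnd_pow_apply hJle e]
  funext i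
  have hi := congrFun h i
  simp only at hi
  rw [hi, neg_neg]

end Summit.BirchSwinnertonDyer.BirchSwinnertonDyer.Rank1Residual.KolyvaginTwist

end
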